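import Mathlib.Analysis.Calculus.BumpFunction.Normed
import Mathlib.Analysis.Calculus.BumpFunction.InnerProduct
import Literature.NumberTheory.LFunctions.WeilExplicitFormulaProofs
import Literature.NumberTheory.LFunctions.WeilExplicitProofs
import HarnessLib

/-!
# The Guinand–Weil explicit formula for continuous compactly supported test functions

Topic `Literature/NumberTheory/LFunctions`. Everything in this file is PROVED (no named facts; the
only definitions are the standard mollifiers used in the proof).

The tree proves the explicit formula `lim_T Σ_{|Im ρ|≤T} m(ρ) ĝ(ρ) = W(g)` for SMOOTH compactly
supported `g` (`Literature.NumberTheory.LFunctions.explicit_formula_holds`, Bombieri 2000, Thm. 2).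
Applications of Selberg–Goldston–Gonek type (Balazard–de Roton, arXiv:0810.3587, Prop. 11 and the
proof of Prop. 15: "`f(u) = F₊(u − t)` vérifie les hypothèses de la proposition 11") use test
functions whose prime-side kernel `g` (the Fourier transform of a Beurling–Selberg function) is
only continuous with compact support. This file extends the formula to that class:

* `Literature.NumberTheory.LFunctions.explicit_formula_continuous` — for `g : ℝ → ℂ` continuous
  with compact support such that the zero side converges absolutely
  (`Σ_ρ ‖m(ρ) ĝ(ρ)‖ < ∞`) and the archimedean integrand `ĝ(½+it) Re ψ(¼+it/2)` is integrable,
  `HasWeilZeroSide g (weilFunctional g)`.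

Proof: mollify, `g_k = g ⋆ φ_k` with `φ_k` a normalised smooth bump of radius `1/(k+1)`
(`Literature.NumberTheory.LFunctions.WeilContinuous.moll`); `g_k` is a test function, so
`Σ_ρ m(ρ) ĝ_k(ρ) = W(g_k)` (tree); `ĝ_k = ĝ · φ̂_k` (`weilMellin_weilConv_holds`) with
`|φ̂_k| ≤ e^{|Re s − ½|}`, `φ̂_k(s) → 1`; dominated convergence on the zero side (sums) and on the
archimedean side (integrals), finiteness of the prime side, and `g_k → g` pointwise give
`Σ_ρ m(ρ) ĝ(ρ) = W(g)`.

## References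

* [Bombieri2000Weil] E. Bombieri, Rend. Mat. Acc. Lincei (9) 11 (2000), Thm. 2 (the formula).
* [BalazardDeRoton2008] M. Balazard, A. de Roton, arXiv:0810.3587, Prop. 11 (the class of test
  functions: "`h` analytique dans la bande `|Im s| ≤ ½ + ε`, `h(s) ≪ (1+|s|)^{−1−δ}`").
  [cite: BalazardDeRoton2008, Prop. 11]
-/

noncomputable section

open Complex Filter Set MeasureTheory Topology
open scoped Real Convolution ComplexConjugate ContDiff

namespace Literature.NumberTheory.LFunctions

namespace WeilContinuous

/-! ## Mollifiers -/

/-- The smooth bump of radii `1/(2(k+1)) < 1/(k+1)` centred at `0`. [folklore] -/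
def bump (k : ℕ) : ContDiffBump (0 : ℝ) where
  rIn := 1 / (2 * ((k : ℝ) + 1))
  rOut := 1 / ((k : ℝ) + 1)
  rIn_pos := by positivity
  rIn_lt_rOut := by
    rw [div_lt_div_iff₀ (by positivity) (by positivity)]
    nlinarith [(Nat.cast_nonneg k : (0 : ℝ) ≤ k)]

/-- The mollifier `φ_k`: the bump normalised to integral `1`, as a complex function. [folklore] -/
def moll (k : ℕ) (x : ℝ) : ℂ := ((bump k).normed volume x : ℂ)

/-- `rOut = 1/(k+1)`. [folklore] -/
lemma bump_rOut (k : ℕ) : (bump k).rOut = 1 / ((k : ℝ) + 1) := rfl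

/-- `1/(k+1) ≤ 1`. [folklore] -/
lemma bump_rOut_le_one (k : ℕ) : (bump k).rOut ≤ 1 := by
  rw [bump_rOut, div_le_one (by positivity)]
  linarith [(Nat.cast_nonneg k : (0 : ℝ) ≤ k)]

/-- `rOut → 0`. [folklore] -/
lemma tendsto_bump_rOut : Tendsto (fun k ↦ (bump k).rOut) atTop (𝓝 0) := by
  simp_rw [bump_rOut]
  exact tendsto_one_div_add_atTop_nhds_zero_nat

/-- `φ_k` is smooth. [folklore] -/
lemma contDiff_moll (k : ℕ) : ContDiff ℝ ∞ (moll k) :=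
  Complex.ofRealCLM.contDiff.comp (bump k).contDiff_normed

/-- `φ_k` is continuous. [folklore] -/
lemma continuous_moll (k : ℕ) : Continuous (moll k) :=
  Complex.continuous_ofReal.comp (bump k).continuous_normed

/-- `φ_k` has compact support. [folklore] -/
lemma hasCompactSupport_moll (k : ℕ) : HasCompactSupport (moll k) :=
  (bump k).hasCompactSupport_normed.comp_left (g := fun r : ℝ ↦ (r : ℂ)) Complex.ofReal_zero

/-- `φ_k` is a test function. [folklore] -/
lemma isWeilTest_moll (k : ℕ) : IsWeilTest (moll k) := ⟨contDiff_moll k, hasCompactSupport_moll k⟩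

/-- `φ_k(x) = 0` for `|x| ≥ 1/(k+1)`. [folklore] -/
lemma moll_eq_zero {k : ℕ} {x : ℝ} (hx : (bump k).rOut ≤ |x|) : moll k x = 0 := by
  have h : (bump k).normed volume x = 0 := by
    have : x ∉ Function.support ((bump k).normed volume) := by
      rw [(bump k).support_normed_eq, Metric.mem_ball, dist_zero_right, Real.norm_eq_abs, not_lt]
      exact hx
    simpa [Function.mem_support] using this
  simp [moll, h]

/-- `φ_k ≥ 0` (as a real number). [folklore] -/
lemma moll_eq_ofReal_nonneg (k : ℕ) (x : ℝ) : ∃ r : ℝ, 0 ≤ r ∧ moll k x = r :=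
  ⟨(bump k).normed volume x, (bump k).nonneg_normed x, rfl⟩

/-- `‖φ_k(x)‖ = φ_k(x)` (the real bump). [folklore] -/
lemma norm_moll (k : ℕ) (x : ℝ) : ‖moll k x‖ = (bump k).normed volume x := by
  rw [moll, Complex.norm_real, Real.norm_eq_abs, abs_of_nonneg ((bump k).nonneg_normed x)]

/-- `∫ φ_k = 1`. [folklore] -/
lemma integral_moll (k : ℕ) : ∫ x, moll k x = 1 := by
  unfold moll
  rw [integral_complex_ofReal, (bump k).integral_normed]
  simp

/-- `∫ ‖φ_k‖ = 1`. [folklore] -/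
lemma integral_norm_moll (k : ℕ) : ∫ x, ‖moll k x‖ = 1 := by
  simp_rw [norm_moll]
  exact (bump k).integral_normed

/-- `‖φ_k‖` is integrable. [folklore] -/
lemma integrable_norm_moll (k : ℕ) : Integrable fun x ↦ ‖moll k x‖ :=
  ((continuous_moll k).integrable_of_hasCompactSupport (hasCompactSupport_moll k)).norm

/-! ## The transform of the mollifier -/

/-- `|φ̂_k(s)| ≤ e^{|Re s − ½|}`. [folklore] -/
theorem norm_weilMellin_moll_le (k : ℕ) (s : ℂ) :
    ‖weilMellin (moll k) s‖ ≤ Real.exp |s.re - 1 / 2| := by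
  unfold weilMellin
  calc ‖∫ t : ℝ, moll k t * cexp ((s - 1 / 2) * t)‖ ≤ ∫ t : ℝ, ‖moll k t * cexp ((s - 1 / 2) * t)‖ :=
        norm_integral_le_integral_norm _
    _ ≤ ∫ t : ℝ, ‖moll k t‖ * Real.exp |s.re - 1 / 2| := by
        refine integral_mono_of_nonneg (Eventually.of_forall fun _ ↦ norm_nonneg _)
          ((integrable_norm_moll k).mul_const _) (Eventually.of_forall fun t ↦ ?_)
        simp only [norm_mul, Complex.norm_exp]
        rcases le_or_gt (bump k).rOut |t| with ht | ht
        · rw [moll_eq_zero ht]; simp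
        · refine mul_le_mul_of_nonneg_left (Real.exp_le_exp.2 ?_) (norm_nonneg _)
          have hre : ((s - 1 / 2) * (t : ℂ)).re = (s.re - 1 / 2) * t := by simp [sub_re, mul_re]
          rw [hre]
          have ht1 : |t| ≤ 1 := (ht.le.trans (bump_rOut_le_one k))
          calc (s.re - 1 / 2) * t ≤ |(s.re - 1 / 2) * t| := le_abs_self _
            _ = |s.re - 1 / 2| * |t| := abs_mul _ _
            _ ≤ |s.re - 1 / 2| * 1 := by gcongr
            _ = |s.re - 1 / 2| := mul_one _
    _ = Real.exp |s.re - 1 / 2| := by rw [MeasureTheory.integral_mul_const, integral_norm_moll, one_mul]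

/-- On the critical line `|φ̂_k(½ + it)| ≤ 1`. [folklore] -/
theorem norm_weilMellin_moll_half_le (k : ℕ) (t : ℝ) :
    ‖weilMellin (moll k) (1 / 2 + t * I)‖ ≤ 1 := by
  have h := norm_weilMellin_moll_le k (1 / 2 + t * I)
  simp only [add_re, mul_re, I_re, I_im, ofReal_re, ofReal_im] at h
  norm_num at h
  exact h

/-- `φ̂_k(s) → 1` as `k → ∞`. [folklore] -/
theorem tendsto_weilMellin_moll (s : ℂ) :
    Tendsto (fun k ↦ weilMellin (moll k) s) atTop (𝓝 1) := by
  set c : ℂ := s - 1 / 2 with hc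
  -- `φ̂_k(s) − 1 = ∫ φ_k(t)(e^{ct} − 1) dt`
  have hdiff : ∀ k, weilMellin (moll k) s - 1 = ∫ t : ℝ, moll k t * (cexp (c * t) - 1) := by
    intro k
    have h1 : weilMellin (moll k) s - 1 = weilMellin (moll k) s - ∫ t : ℝ, moll k t := by
      rw [integral_moll]
    rw [h1]
    unfold weilMellin
    rw [← integral_sub]
    · refine integral_congr_ae (Eventually.of_forall fun t ↦ ?_)
      rw [hc]; ring
    · exact integrable_weilIntegrand (continuous_moll k) (hasCompactSupport_moll k) s
    · exact (continuous_moll k).integrable_of_hasCompactSupport (hasCompactSupport_moll k)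
  -- bound `‖φ̂_k(s) − 1‖ ≤ 2 ‖c‖ r_k` once `‖c‖ r_k ≤ 1`
  have hbound : ∀ k, ‖c‖ * (bump k).rOut ≤ 1 → ‖weilMellin (moll k) s - 1‖ ≤ 2 * (‖c‖ * (bump k).rOut) := by
    intro k hk1
    rw [hdiff k]
    calc ‖∫ t : ℝ, moll k t * (cexp (c * t) - 1)‖ ≤ ∫ t : ℝ, ‖moll k t * (cexp (c * t) - 1)‖ :=
          norm_integral_le_integral_norm _
      _ ≤ ∫ t : ℝ, ‖moll k t‖ * (2 * (‖c‖ * (bump k).rOut)) := by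
          refine integral_mono_of_nonneg (Eventually.of_forall fun _ ↦ norm_nonneg _)
            ((integrable_norm_moll k).mul_const _) (Eventually.of_forall fun t ↦ ?_)
          simp only [norm_mul]
          rcases le_or_gt (bump k).rOut |t| with ht | ht
          · rw [moll_eq_zero ht]; simp
          · refine mul_le_mul_of_nonneg_left ?_ (norm_nonneg _)
            have hct : ‖c * (t : ℂ)‖ ≤ ‖c‖ * (bump k).rOut := by
              rw [norm_mul, Complex.norm_real, Real.norm_eq_abs]; gcongr
            have h1 := Complex.norm_exp_sub_one_le (x := c * (t : ℂ)) (hct.trans hk1)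
            calc ‖cexp (c * (t : ℂ)) - 1‖ ≤ 2 * ‖c * (t : ℂ)‖ := h1
              _ ≤ 2 * (‖c‖ * (bump k).rOut) := by gcongr
      _ = 2 * (‖c‖ * (bump k).rOut) := by
          rw [MeasureTheory.integral_mul_const, integral_norm_moll, one_mul]
  have hlim : Tendsto (fun k ↦ 2 * (‖c‖ * (bump k).rOut)) atTop (𝓝 (2 * (‖c‖ * 0))) :=
    (tendsto_bump_rOut.const_mul ‖c‖).const_mul 2
  rw [mul_zero, mul_zero] at hlim
  have hev : ∀ᶠ k in atTop, ‖weilMellin (moll k) s - 1‖ ≤ 2 * (‖c‖ * (bump k).rOut) := by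
    have h1 : Tendsto (fun k ↦ ‖c‖ * (bump k).rOut) atTop (𝓝 (‖c‖ * 0)) := tendsto_bump_rOut.const_mul ‖c‖
    rw [mul_zero] at h1
    filter_upwards [(tendsto_order.1 h1).2 1 one_pos] with k hk
    exact hbound k hk.le
  have h0 : Tendsto (fun k ↦ weilMellin (moll k) s - 1) atTop (𝓝 0) :=
    squeeze_zero_norm' hev hlim
  have := h0.add_const 1
  simpa using this

/-! ## Mollification of a continuous compactly supported function -/

variable {g : ℝ → ℂ}

/-- `g ⋆ φ_k` is a test function when `g` is continuous with compact support. [folklore] -/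
theorem isWeilTest_weilConv_moll (hgc : Continuous g) (hgs : HasCompactSupport g) (k : ℕ) :
    IsWeilTest (weilConv g (moll k)) := by
  rw [weilConv_eq_convolution_real]
  exact ⟨(hasCompactSupport_moll k).contDiff_convolution_right (ContinuousLinearMap.mul ℝ ℂ)
      hgc.locallyIntegrable (contDiff_moll k),
    HasCompactSupport.convolution (L := ContinuousLinearMap.mul ℝ ℂ) hgs (hasCompactSupport_moll k)⟩

/-- `(g ⋆ φ_k)^ = ĝ · φ̂_k`. [cite: Bombieri2000Weil, §3] -/
theorem weilMellin_weilConv_moll (hgc : Continuous g) (hgs : HasCompactSupport g) (k : ℕ) (s : ℂ) :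
    weilMellin (weilConv g (moll k)) s = weilMellin g s * weilMellin (moll k) s :=
  weilMellin_weilConv_holds hgc hgs (continuous_moll k) (hasCompactSupport_moll k) s

/-- **Approximate identity**: `(g ⋆ φ_k)(x) → g(x)` for continuous `g`. [folklore] -/
theorem tendsto_weilConv_moll (hgc : Continuous g) (x : ℝ) :
    Tendsto (fun k ↦ weilConv g (moll k) x) atTop (𝓝 (g x)) := by
  rw [Metric.tendsto_nhds]
  intro ε hε
  -- continuity of `g` at `x`
  obtain ⟨δ, hδ, hδg⟩ := Metric.continuous_iff.1 hgc x (ε / 2) (by positivity)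
  have hk : ∀ᶠ k : ℕ in atTop, (bump k).rOut < δ :=
    (tendsto_order.1 tendsto_bump_rOut).2 δ hδ
  filter_upwards [hk] with k hk
  have hconv : weilConv g (moll k) x = ∫ u : ℝ, g u * moll k (x - u) := weilConv_apply g (moll k) x
  have hone : ∫ u : ℝ, moll k (x - u) = 1 := by
    rw [integral_sub_left_eq_self (fun u ↦ moll k u) volume x, integral_moll]
  have hgx : g x = ∫ u : ℝ, g x * moll k (x - u) := by
    rw [MeasureTheory.integral_const_mul, hone, mul_one]
  have hint1 : Integrable fun u : ℝ ↦ g u * moll k (x - u) := by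
    have hc : Continuous fun u : ℝ ↦ g u * moll k (x - u) := hgc.mul ((continuous_moll k).comp (by fun_prop))
    refine hc.integrable_of_hasCompactSupport ?_
    exact ((hasCompactSupport_moll k).comp_homeomorph (Homeomorph.subLeft x)).mul_left
  have hint2 : Integrable fun u : ℝ ↦ g x * moll k (x - u) := by
    have hc : Continuous fun u : ℝ ↦ moll k (x - u) := (continuous_moll k).comp (by fun_prop)
    exact (hc.integrable_of_hasCompactSupport
      ((hasCompactSupport_moll k).comp_homeomorph (Homeomorph.subLeft x))).const_mul _
  rw [dist_eq_norm, hconv, hgx, ← integral_sub hint1 hint2]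
  have hb : ∀ u : ℝ, ‖g u * moll k (x - u) - g x * moll k (x - u)‖ ≤ ε / 2 * ‖moll k (x - u)‖ := by
    intro u
    rw [← sub_mul, norm_mul]
    rcases le_or_gt (bump k).rOut |x - u| with hu | hu
    · rw [moll_eq_zero hu]; simp
    · refine mul_le_mul_of_nonneg_right ?_ (norm_nonneg _)
      have hdist : dist u x < δ := by
        rw [dist_comm, Real.dist_eq]; exact hu.trans hk
      exact (le_of_lt (by simpa [dist_eq_norm] using hδg u hdist))
  calc ‖∫ u : ℝ, (g u * moll k (x - u) - g x * moll k (x - u))‖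
      ≤ ∫ u : ℝ, ‖g u * moll k (x - u) - g x * moll k (x - u)‖ := norm_integral_le_integral_norm _
    _ ≤ ∫ u : ℝ, ε / 2 * ‖moll k (x - u)‖ :=
        integral_mono_of_nonneg (Eventually.of_forall fun _ ↦ norm_nonneg _)
          (((integrable_norm_moll k).comp_sub_left x).const_mul _) (Eventually.of_forall hb)
    _ = ε / 2 := by
        rw [MeasureTheory.integral_const_mul, integral_sub_left_eq_self (fun u ↦ ‖moll k u‖) volume x,
          integral_norm_moll, mul_one]
    _ < ε := by linarith

/-- The mollified function vanishes one unit beyond the support of `g`. [folklore] -/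
theorem weilConv_moll_eq_zero {R : ℝ} (hgs : ∀ u : ℝ, R < |u| → g u = 0) {x : ℝ} (hx : R + 1 < |x|) (k : ℕ) :
    weilConv g (moll k) x = 0 := by
  rw [weilConv_apply]
  refine integral_eq_zero_of_ae (Eventually.of_forall fun u ↦ ?_)
  simp only [Pi.zero_apply]
  rcases le_or_gt (bump k).rOut |x - u| with hu | hu
  · rw [moll_eq_zero hu, mul_zero]
  · have h1 : |x - u| < 1 := hu.trans_le (bump_rOut_le_one k)
    have h2 : R < |u| := by
      have := abs_sub_abs_le_abs_sub x u
      linarith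
    rw [hgs u h2, zero_mul]

/-! ## The three sides along the mollification -/

/-- Radius of the support of `g`. [folklore] -/
theorem exists_support_radius (hgs : HasCompactSupport g) :
    ∃ R : ℝ, 0 ≤ R ∧ ∀ u : ℝ, R < |u| → g u = 0 := by
  obtain ⟨R, hR⟩ := hgs.isCompact.isBounded.subset_closedBall 0
  refine ⟨|R|, abs_nonneg R, fun u hu ↦ image_eq_zero_of_notMem_tsupport fun hus ↦ ?_⟩
  have := hR hus
  rw [Metric.mem_closedBall, dist_zero_right, Real.norm_eq_abs] at this
  linarith [le_abs_self R]

/-- The prime term as a finite sum when the kernel vanishes for `|u| > R`. [folklore] -/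
theorem weilPrimeTerm_eq_sum_of_support {f : ℝ → ℂ} {R : ℝ} (hf : ∀ u : ℝ, R < |u| → f u = 0) :
    weilPrimeTerm f = ∑ n ∈ Finset.range ⌈Real.exp (R + 1)⌉₊,
      ((ArithmeticFunction.vonMangoldt n : ℝ) : ℂ) / (Real.sqrt n : ℂ) * (f (Real.log n) + f (-Real.log n)) := by
  unfold weilPrimeTerm
  refine tsum_eq_sum fun n hn ↦ ?_
  rw [Finset.mem_range, not_lt] at hn
  have hn' : Real.exp (R + 1) ≤ n := (Nat.le_ceil _).trans (by exact_mod_cast hn)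
  have hpos : (0 : ℝ) < n := (Real.exp_pos _).trans_le hn'
  have hlog : R + 1 ≤ Real.log n := by rwa [Real.le_log_iff_exp_le hpos]
  have h1 : R < |Real.log n| := lt_of_lt_of_le (by linarith) (le_abs_self _)
  rw [hf _ h1, hf _ (by rwa [abs_neg]), add_zero, mul_zero]

/-- Convergence of the prime term along the mollification. [folklore] -/
theorem tendsto_weilPrimeTerm_moll (hgc : Continuous g) (hgs : HasCompactSupport g) :
    Tendsto (fun k ↦ weilPrimeTerm (weilConv g (moll k))) atTop (𝓝 (weilPrimeTerm g)) := by
  obtain ⟨R, hR0, hR⟩ := exists_support_radius hgs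
  have hRk : ∀ k, ∀ u : ℝ, R + 1 < |u| → weilConv g (moll k) u = 0 := fun k u hu ↦
    weilConv_moll_eq_zero hR hu k
  have hR' : ∀ u : ℝ, R + 1 < |u| → g u = 0 := fun u hu ↦ hR u (by linarith)
  rw [weilPrimeTerm_eq_sum_of_support hR']
  simp_rw [weilPrimeTerm_eq_sum_of_support (hRk _)]
  refine tendsto_finsetSum _ fun n _ ↦ ?_
  exact tendsto_const_nhds.mul ((tendsto_weilConv_moll hgc _).add (tendsto_weilConv_moll hgc _))

/-- Convergence of the polar term along the mollification. [folklore] -/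
theorem tendsto_weilPolarTerm_moll (hgc : Continuous g) (hgs : HasCompactSupport g) :
    Tendsto (fun k ↦ weilPolarTerm (weilConv g (moll k))) atTop (𝓝 (weilPolarTerm g)) := by
  unfold weilPolarTerm
  simp_rw [weilMellin_weilConv_moll hgc hgs]
  have h0 := (tendsto_weilMellin_moll 0).const_mul (weilMellin g 0)
  have h1 := (tendsto_weilMellin_moll 1).const_mul (weilMellin g 1)
  simpa using h0.add h1

/-- Convergence of the archimedean integral along the mollification (dominated convergence).
[folklore] -/
theorem tendsto_weilArchIntegral_moll (hgc : Continuous g) (hgs : HasCompactSupport g)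
    (hA : Integrable fun t : ℝ ↦ weilMellin g (1 / 2 + t * I) * ((Complex.digamma (1 / 4 + t / 2 * I)).re : ℂ)) :
    Tendsto (fun k ↦ weilArchIntegral (weilConv g (moll k))) atTop (𝓝 (weilArchIntegral g)) := by
  unfold weilArchIntegral
  simp_rw [weilMellin_weilConv_moll hgc hgs]
  refine tendsto_integral_of_dominated_convergence
    (fun t ↦ ‖weilMellin g (1 / 2 + t * I) * ((Complex.digamma (1 / 4 + t / 2 * I)).re : ℂ)‖) ?_ hA.norm ?_ ?_
  · intro k
    have hc : Continuous fun t : ℝ ↦ weilMellin (moll k) (1 / 2 + t * I) :=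
      (continuous_weilMellin (continuous_moll k) (hasCompactSupport_moll k)).comp (by fun_prop)
    have heq : (fun t : ℝ ↦ weilMellin g (1 / 2 + t * I) * weilMellin (moll k) (1 / 2 + t * I) *
        ((Complex.digamma (1 / 4 + t / 2 * I)).re : ℂ)) = fun t : ℝ ↦
        (weilMellin g (1 / 2 + t * I) * ((Complex.digamma (1 / 4 + t / 2 * I)).re : ℂ)) *
          weilMellin (moll k) (1 / 2 + t * I) := by
      funext t; ring
    rw [heq]
    exact hA.aestronglyMeasurable.mul hc.aestronglyMeasurable
  · intro k
    refine Eventually.of_forall fun t ↦ ?_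
    have h1 := norm_weilMellin_moll_half_le k t
    calc ‖weilMellin g (1 / 2 + t * I) * weilMellin (moll k) (1 / 2 + t * I) *
          ((Complex.digamma (1 / 4 + t / 2 * I)).re : ℂ)‖
        = ‖weilMellin g (1 / 2 + t * I) * ((Complex.digamma (1 / 4 + t / 2 * I)).re : ℂ)‖ *
            ‖weilMellin (moll k) (1 / 2 + t * I)‖ := by
          rw [norm_mul, norm_mul, norm_mul]; ring
      _ ≤ ‖weilMellin g (1 / 2 + t * I) * ((Complex.digamma (1 / 4 + t / 2 * I)).re : ℂ)‖ * 1 := by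
          gcongr
      _ = _ := mul_one _
  · refine Eventually.of_forall fun t ↦ ?_
    have h := ((tendsto_weilMellin_moll (1 / 2 + t * I)).const_mul (weilMellin g (1 / 2 + t * I))).mul_const
      ((Complex.digamma (1 / 4 + t / 2 * I)).re : ℂ)
    simpa using h

/-- Convergence of the full functional along the mollification. [folklore] -/
theorem tendsto_weilFunctional_moll (hgc : Continuous g) (hgs : HasCompactSupport g)
    (hA : Integrable fun t : ℝ ↦ weilMellin g (1 / 2 + t * I) * ((Complex.digamma (1 / 4 + t / 2 * I)).re : ℂ)) :
    Tendsto (fun k ↦ weilFunctional (weilConv g (moll k))) atTop (𝓝 (weilFunctional g)) := by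
  unfold weilFunctional weilArchTerm
  refine ((tendsto_weilPolarTerm_moll hgc hgs).sub (tendsto_weilPrimeTerm_moll hgc hgs)).add ?_
  refine ((tendsto_weilArchIntegral_moll hgc hgs hA).const_mul _).sub ?_
  exact (tendsto_weilConv_moll hgc 0).mul_const _

/-- Convergence of the (absolutely convergent) zero side along the mollification (dominated
convergence for series). [folklore] -/
theorem tendsto_zeroSide_moll (hgc : Continuous g) (hgs : HasCompactSupport g)
    (hZ : Summable fun ρ : ZetaZeros.riemannZetaNontrivialZeros ↦
      ‖(riemannZetaZeroOrder (ρ : ℂ) : ℂ) * weilMellin g ρ‖) :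
    Tendsto (fun k ↦ ∑' ρ : ZetaZeros.riemannZetaNontrivialZeros,
      (riemannZetaZeroOrder (ρ : ℂ) : ℂ) * weilMellin (weilConv g (moll k)) ρ) atTop
      (𝓝 (∑' ρ : ZetaZeros.riemannZetaNontrivialZeros, (riemannZetaZeroOrder (ρ : ℂ) : ℂ) * weilMellin g ρ)) := by
  simp_rw [weilMellin_weilConv_moll hgc hgs]
  refine tendsto_tsum_of_dominated_convergence (bound := fun ρ : ZetaZeros.riemannZetaNontrivialZeros ↦
    ‖(riemannZetaZeroOrder (ρ : ℂ) : ℂ) * weilMellin g ρ‖ * Real.exp (1 / 2)) (hZ.mul_right _) ?_ ?_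
  · intro ρ
    have h := (tendsto_weilMellin_moll (ρ : ℂ)).const_mul ((riemannZetaZeroOrder (ρ : ℂ) : ℂ) * weilMellin g ρ)
    simpa [mul_assoc] using h
  · refine Eventually.of_forall fun k ρ ↦ ?_
    rw [← mul_assoc, norm_mul]
    refine mul_le_mul_of_nonneg_left ?_ (norm_nonneg _)
    refine (norm_weilMellin_moll_le k ρ).trans (Real.exp_le_exp.2 ?_)
    have h0 := ZetaZeros.riemannZetaNontrivialZeros.re_pos ρ.2
    have h1 := ZetaZeros.riemannZetaNontrivialZeros.re_lt_one ρ.2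
    exact abs_le.2 ⟨by linarith, by linarith⟩

end WeilContinuous

open WeilContinuous in
/-- **The Guinand–Weil explicit formula for continuous compactly supported test functions.** Let
`g : ℝ → ℂ` be continuous with compact support, and suppose that the zero side converges
absolutely, `Σ_ρ ‖m(ρ) ĝ(ρ)‖ < ∞`, and that `t ↦ ĝ(½+it) Re ψ(¼+it/2)` is integrable. Then
`lim_{T→∞} Σ_{|Im ρ|≤T} m(ρ) ĝ(ρ) = W(g) = ĝ(0) + ĝ(1) − Σ Λ(n)n^{−½}(g(log n) + g(−log n))
+ (1/2π)∫ ĝ(½+it) Re ψ(¼+it/2) dt − g(0) log π` (Bombieri 2000, Thm. 2, for the class of test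
functions of Balazard–de Roton 2008, Prop. 11, by mollification from the tree's
`explicit_formula_holds`). [cite: BalazardDeRoton2008, Prop. 11] -/
theorem explicit_formula_continuous {g : ℝ → ℂ} (hgc : Continuous g) (hgs : HasCompactSupport g)
    (hZ : Summable fun ρ : ZetaZeros.riemannZetaNontrivialZeros ↦
      ‖(riemannZetaZeroOrder (ρ : ℂ) : ℂ) * weilMellin g ρ‖)
    (hA : Integrable fun t : ℝ ↦ weilMellin g (1 / 2 + t * I) * ((Complex.digamma (1 / 4 + t / 2 * I)).re : ℂ)) :
    HasWeilZeroSide g (weilFunctional g) := by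
  -- for each `k`: `Σ' m ĝ_k = W(g_k)`
  have hk : ∀ k : ℕ, ∑' ρ : ZetaZeros.riemannZetaNontrivialZeros,
      (riemannZetaZeroOrder (ρ : ℂ) : ℂ) * weilMellin (weilConv g (moll k)) ρ =
        weilFunctional (weilConv g (moll k)) := by
    intro k
    have htest := isWeilTest_weilConv_moll hgc hgs k
    have h1 : HasWeilZeroSide (weilConv g (moll k)) (weilFunctional (weilConv g (moll k))) :=
      explicit_formula_holds htest
    have h2 := hasWeilZeroSide_tsum (summable_norm_zeroSide htest)
    exact tendsto_nhds_unique h2 h1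
  have hlim1 := tendsto_zeroSide_moll hgc hgs hZ
  have hlim2 := tendsto_weilFunctional_moll hgc hgs hA
  simp_rw [hk] at hlim1
  have heq := tendsto_nhds_unique hlim1 hlim2
  rw [← heq]
  exact hasWeilZeroSide_tsum hZ

end Literature.NumberTheory.LFunctions
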